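import Mathlib
import Literature.AlgebraicGeometry.Resolution.PolygonInvariants
import HarnessLib

/-!
# Cutkosky 2009: the invariant `Ω = (β, 1/ε, α)` of the characteristic polygon (`τ = 1` case)

Topic: `Literature/AlgebraicGeometry/Resolution`.  S. D. Cutkosky, *Resolution of singularities
for 3-folds in positive characteristic*, Amer. J. Math. **131** (2009) 59–127 [cite: Cutkosky2009],
§10 "Reduction when `τ(q) = 1`" (pp. 28–37; "The proof is based on Hironaka's termination
argument in [H2]" = the Bowdoin lectures).  For an ideal `I` of a power series ring
`T = k⟦x, y, z⟧` (`k` algebraically closed, any characteristic), regular parameters `(x, y, z)` and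
`r = ν_T(I)`, §10.1 (p. 28 l. 8–53) defines

  `Δ(I; x, y, z) = {(i/(r−k), j/(r−k)) ∈ ℚ² | k < r and b_{ijk}(g) ≠ 0 for some g ∈ I}`,

`|Δ|` = the smallest convex set containing `Δ` and stable under `+ ℝ²_{≥0}`; "`α_{xyz}(I)` to be the
smallest `a` appearing in any `(a, b) ∈ |Δ|`, `β_{xyz}(I)` to be the smallest `b` such that
`(α_{xyz}(I), b) ∈ |Δ|`"; "`γ_{xyz}(I)` … the smallest number `γ` such that `S(γ) ∩ |Δ| ≠ ∅`"
(`S(γ)` the line through `(γ, 0)` of slope `−1`), "`δ_{xyz}(I)` … such that `(γ − δ, δ)` is the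
lowest point on `S(γ) ∩ |Δ|`"; "Define `ε_{xyz}(I)` to be the absolute value of the largest slope of
a line through `(α_{xyz}(I), β_{xyz}(I))` such that no points of `|Δ|` lie below it"; and

  "`Ω(I; x, y, z) = (β_{xyz}(I), 1/ε_{xyz}(I), α_{xyz}(I))` which is in the ordered set (by the Lex
  order) `(1/r!)ℕ × (ℚ ∪ ∞) × (1/r!)ℕ`" (p. 28 l. 38–53).

## Dictionary with the tree (CITED, not retyped)

`PolygonInvariants.lean` / `WeightedInitialTerms.lean` type Hironaka's polygon of `(J, μ)` for an
ideal `J` of a ring `R` with a triple `c = (c 0, c 1, c 2) = (y, u₁, u₂)` EXPANSION-FREE, through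
the Newton point set `pts c J μ` (exponents `e` with `e 0 < μ`) and the SCALED coordinates
`spt₁ μ e = e₁ · L/(μ − e₀)`, `spt₂ μ e = e₂ · L/(μ − e₀)`, `L = μ!`.  Dictionary: `z ↔ c 0`,
`x ↔ c 1`, `y ↔ c 2`, `r ↔ μ`, `(a, b) = (i/(r−k), j/(r−k)) ↔ (spt₁ μ e, spt₂ μ e)/L`; hence
`L·α_{xyz} = alphaS c J μ`, `L·β_{xyz} = betaS c J μ`, `L·γ_{xyz} = deltaS c J μ`,
`L·δ_{xyz} = gammaMinusS c J μ` (CJS Def. 11.1 names on the tree side).  For `T = k⟦x,y,z⟧` the set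
`|Δ|` generated by `pts` is the printed one: both are cut out by the same positive half-planes
(`le_weightedIdealW_iff_forall_occ` ★ of `WeightedInitialTerms`; p. 28 observation 1 "The vertices
of `|Δ|` are points of `Δ`").  CAUTION — NAME CLASH: the tree's `epsS` is CJS's `ε = min` ordinate
(Def. 11.1), NOT Cutkosky's slope `ε`; Cutkosky's `ε` is `Cutkosky2009.epsCu` below.

## What this file adds (all PROVED; no named fact here)

* `Cutkosky2009.lowPts`, `slopeOf`, `slopeSet`, `epsCu` — Cutkosky's `ε` read on the generating
  points: the largest of `0` and the slopes `(β − b)/(a − α)` from the vertex `v = (α, β)` down to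
  the Newton points strictly below the level `β`; `sub_le_epsCu_mul` ("no point of `Δ` lies below
  the line of slope `−ε` through `v`"), `isGreatest_slope_through_vertex` (`−ε` is the LARGEST
  non-positive such slope — positive slopes are excluded by `(α + t, β) ∈ |Δ|`), `epsCu_eq_zero_iff`;
* `Cutkosky2009.invEpsCu : WithTop ℚ` (`1/ε`, `⊤ = ∞` for `ε = 0`) and
  `Cutkosky2009.OmegaCu c J μ : ℕ ×ₗ (WithTop ℚ ×ₗ ℕ)` = `(L·β, 1/ε, L·α)` in the printed lex order
  (the constant scaling `L = r!` along a sequence with constant `r` changes no comparison);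
* **"the sequence `Ω(q_n)` cannot decrease indefinitely"** (p. 37 l. 78–80; p. 25 l. 24–27): the
  codomain is NOT well-ordered, but a chain `Ω₀ > Ω₁ > …` with middle components `∞` or positive
  obeying Theorem 10.18's law "if `β_{n+1} = β_n`, `ε_{n+1} ≠ ε_n` and `1/ε_n ≠ ∞`, then
  `1/ε_{n+1} = 1/ε_n − 1`" is impossible: `no_infinite_descent`, via the well-founded step relation
  `CuStep` (`wellFounded_cuStep`; potential `(β, [1/ε = ∞], ⌈1/ε⌉, α) ∈ ℕ⁴`, ours).

Theorem 10.18 itself (very well prepared good parameters along the sequence (11) with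
`Ω_{n+1} < Ω_n`) is a NAMED FACT in `CutkoskySurfaceOmegaSequence.lean`.  AI transcription read
on the text layer of the held copy (`paper:doi-10-1353-ajm-0-0036`); weaker than expert review.

## Sources

* S. D. Cutkosky, Amer. J. Math. 131 (2009), §10.1 p. 28; (11) p. 25; Thm. 10.18 p. 36; p. 37. [Cutkosky2009]
* V. Cossart, U. Jannsen, S. Saito, LNM 2270 (2020), Def. 11.1. [CossartJannsenSaito2020]
-/

noncomputable section

open IsLocalRing

namespace Literature.AlgebraicGeometry.Resolution.Cutkosky2009

universe u
variable {R : Type u} [CommRing R]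

/-! ## Cutkosky's `ε`: the steepest descent from the vertex `v = (α, β)` -/
section Eps
variable (c : Fin 3 → R) (J : Ideal R) (μ : ℕ)

/-- The Newton points of `(J, μ)` lying STRICTLY BELOW the level `β` of the vertex `v = (α, β)`
(scaled ordinate `spt₂ < betaS`); these are the points that constrain a line through `v` from
below.  [cite: Cutkosky2009, §10.1 p. 28 l. 35–37] -/
def lowPts : Set (Fin 3 →₀ ℕ) := {e | e ∈ pts c J μ ∧ spt₂ μ e < betaS c J μ}

/-- The absolute slope `(β − b)/(a − α)` of the segment from the vertex `v = (α, β)` to the point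
`(a, b)` of `e` (scale-free: computed on the scaled coordinates).  [cite: Cutkosky2009, §10.1 p. 28 l. 35–37] -/
def slopeOf (e : Fin 3 →₀ ℕ) : ℚ :=
  ((betaS c J μ : ℚ) - spt₂ μ e) / ((spt₁ μ e : ℚ) - alphaS c J μ)

/-- The candidate values for `ε`: `0` together with the slopes down to the points below the level
`β`.  [cite: Cutkosky2009, §10.1 p. 28 l. 35–37] -/
def slopeSet : Set ℚ := insert 0 (slopeOf c J μ '' lowPts c J μ)

variable {c J μ}

/-- A point below the level `β` lies strictly to the right of the vertex: `α < a` (`β` is the least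
ordinate on the line `a = α`). [cite: Cutkosky2009, §10.1 p. 28 l. 29–31] -/
theorem alphaS_lt_spt₁_of_mem_lowPts {e : Fin 3 →₀ ℕ} (he : e ∈ lowPts c J μ) :
    alphaS c J μ < spt₁ μ e := by
  rcases (alphaS_le he.1).lt_or_eq with h | h
  · exact h
  · exact absurd (betaS_le he.1 h.symm) (not_le.mpr he.2)

/-- Slopes down to points below the level `β` are positive. [cite: Cutkosky2009, §10.1 p. 28 l. 35–37] -/
theorem slopeOf_pos_of_mem_lowPts {e : Fin 3 →₀ ℕ} (he : e ∈ lowPts c J μ) :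
    0 < slopeOf c J μ e := by
  have h1 : (alphaS c J μ : ℚ) < spt₁ μ e := by exact_mod_cast alphaS_lt_spt₁_of_mem_lowPts he
  have h2 : (spt₂ μ e : ℚ) < betaS c J μ := by exact_mod_cast he.2
  unfold slopeOf
  exact div_pos (by linarith) (by linarith)

/-- **`ε` exists** ("the largest slope" of the printed definition): the candidate set has a greatest
element (for each ordinate drop `d ≤ L β` the slope `d/n` is largest at the least run `n ≥ 1`;
finitely many `d`). [cite: Cutkosky2009, §10.1 p. 28 l. 35–37] -/
theorem exists_isGreatest_slopeSet : ∃ s, IsGreatest (slopeSet c J μ) s := by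
  classical
  -- runs realising the ordinate drop `d`
  let runs : ℕ → Set ℕ := fun d =>
    (fun e => spt₁ μ e - alphaS c J μ) '' {e | e ∈ lowPts c J μ ∧ betaS c J μ - spt₂ μ e = d}
  let D : Finset ℕ := (Finset.range (betaS c J μ + 1)).filter fun d => (runs d).Nonempty
  let g : ℕ → ℚ := fun d => (d : ℚ) / ((sInf (runs d) : ℕ) : ℚ)
  let cand : Finset ℚ := insert 0 (D.image g)
  have hcne : cand.Nonempty := ⟨0, Finset.mem_insert_self _ _⟩
  refine ⟨cand.max' hcne, ?_, ?_⟩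
  · -- the maximum of the candidates is a member of `slopeSet`
    have hmem := Finset.max'_mem cand hcne
    rcases Finset.mem_insert.mp hmem with h0 | h
    · rw [h0]; exact Set.mem_insert _ _
    · obtain ⟨d, hd, hdeq⟩ := Finset.mem_image.mp h
      have hne : (runs d).Nonempty := (Finset.mem_filter.mp hd).2
      obtain ⟨e, ⟨he, hde⟩, hrun⟩ := (Set.mem_image _ _ _).mp (Nat.sInf_mem hne)
      have hrun' : spt₁ μ e - alphaS c J μ = sInf (runs d) := hrun
      rw [← hdeq]
      refine Set.mem_insert_of_mem _ ⟨e, he, ?_⟩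
      have h1 := alphaS_lt_spt₁_of_mem_lowPts he
      have h2 := he.2
      show slopeOf c J μ e = (d : ℚ) / ((sInf (runs d) : ℕ) : ℚ)
      unfold slopeOf
      rw [← hrun', ← hde, Nat.cast_sub h1.le, Nat.cast_sub h2.le]
  · -- it bounds every member of `slopeSet`
    intro s hs
    rcases Set.mem_insert_iff.mp hs with h0 | h
    · rw [h0]; exact Finset.le_max' _ _ (Finset.mem_insert_self _ _)
    · obtain ⟨e, he, rfl⟩ := h
      have h1 := alphaS_lt_spt₁_of_mem_lowPts he
      have h2 := he.2
      set d := betaS c J μ - spt₂ μ e with hd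
      have hrun : spt₁ μ e - alphaS c J μ ∈ runs d := ⟨e, ⟨he, rfl⟩, rfl⟩
      have hne : (runs d).Nonempty := ⟨_, hrun⟩
      have hdD : d ∈ D := by
        refine Finset.mem_filter.mpr ⟨Finset.mem_range.mpr ?_, hne⟩
        omega
      have hle : sInf (runs d) ≤ spt₁ μ e - alphaS c J μ := Nat.sInf_le hrun
      have hpos : 0 < sInf (runs d) := by
        obtain ⟨e', ⟨he', -⟩, hrun'⟩ := (Set.mem_image _ _ _).mp (Nat.sInf_mem hne)
        have hrun'' : spt₁ μ e' - alphaS c J μ = sInf (runs d) := hrun'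
        have := alphaS_lt_spt₁_of_mem_lowPts he'
        omega
      have hgd : g d ∈ cand := Finset.mem_insert_of_mem (Finset.mem_image.mpr ⟨d, hdD, rfl⟩)
      calc slopeOf c J μ e = (d : ℚ) / ((spt₁ μ e - alphaS c J μ : ℕ) : ℚ) := by
            unfold slopeOf
            rw [hd, Nat.cast_sub h2.le, Nat.cast_sub h1.le]
        _ ≤ g d := by
            show (d : ℚ) / ((spt₁ μ e - alphaS c J μ : ℕ) : ℚ) ≤ (d : ℚ) / ((sInf (runs d) : ℕ) : ℚ)
            apply div_le_div_of_nonneg_left (by positivity) (by exact_mod_cast hpos)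
            exact_mod_cast hle
        _ ≤ cand.max' hcne := Finset.le_max' _ _ hgd

variable (c J μ)

/-- **Cutkosky's `ε_{xyz}(I)`** ("the absolute value of the largest slope of a line through
`(α_{xyz}(I), β_{xyz}(I))` such that no points of `|Δ|` lie below it"), read on the generating
points: the greatest element of `slopeSet` — the steepest slope from the vertex `v` down to a Newton
point below the level `β`, and `0` when there is none.  NOT the tree's `epsS` (= CJS's minimal
ordinate).  [cite: Cutkosky2009, §10.1 p. 28 l. 35–37] -/
def epsCu : ℚ := (exists_isGreatest_slopeSet (c := c) (J := J) (μ := μ)).choose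

/-- Defining property of `epsCu`. [cite: Cutkosky2009, §10.1 p. 28 l. 35–37] -/
theorem epsCu_isGreatest : IsGreatest (slopeSet c J μ) (epsCu c J μ) :=
  (exists_isGreatest_slopeSet (c := c) (J := J) (μ := μ)).choose_spec

/-- `ε ≥ 0` (an absolute value). [cite: Cutkosky2009, §10.1 p. 28 l. 35–37] -/
theorem epsCu_nonneg : 0 ≤ epsCu c J μ := (epsCu_isGreatest c J μ).2 (Set.mem_insert _ _)

variable {c J μ}

/-- Every slope down to a point below the level `β` is `≤ ε`. [cite: Cutkosky2009, §10.1 p. 28 l. 35–37] -/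
theorem slopeOf_le_epsCu {e : Fin 3 →₀ ℕ} (he : e ∈ lowPts c J μ) : slopeOf c J μ e ≤ epsCu c J μ :=
  (epsCu_isGreatest c J μ).2 (Set.mem_insert_of_mem _ ⟨e, he, rfl⟩)

/-- **No point of `Δ` lies below the line through `v = (α, β)` of slope `−ε`**: for every Newton
point `(a, b)`, `β − b ≤ ε (a − α)` (scaled coordinates). [cite: Cutkosky2009, §10.1 p. 28 l. 35–37] -/
theorem sub_le_epsCu_mul {e : Fin 3 →₀ ℕ} (he : e ∈ pts c J μ) :
    (betaS c J μ : ℚ) - spt₂ μ e ≤ epsCu c J μ * ((spt₁ μ e : ℚ) - alphaS c J μ) := by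
  have hα : (alphaS c J μ : ℚ) ≤ spt₁ μ e := by exact_mod_cast alphaS_le he
  by_cases hlow : spt₂ μ e < betaS c J μ
  · have hmem : e ∈ lowPts c J μ := ⟨he, hlow⟩
    have h1 : (alphaS c J μ : ℚ) < spt₁ μ e := by exact_mod_cast alphaS_lt_spt₁_of_mem_lowPts hmem
    have := slopeOf_le_epsCu hmem
    unfold slopeOf at this
    rwa [div_le_iff₀ (by linarith)] at this
  · have hβ : (betaS c J μ : ℚ) ≤ spt₂ μ e := by exact_mod_cast not_lt.mp hlow
    have := mul_nonneg (epsCu_nonneg c J μ) (sub_nonneg.mpr hα)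
    linarith

/-- `ε` is `0` or attained at a Newton point below the level `β`. [cite: Cutkosky2009, §10.1 p. 28 l. 35–37] -/
theorem epsCu_eq_zero_or_exists :
    epsCu c J μ = 0 ∨ ∃ e ∈ lowPts c J μ, slopeOf c J μ e = epsCu c J μ := by
  rcases Set.mem_insert_iff.mp (epsCu_isGreatest c J μ).1 with h | ⟨e, he, h⟩
  · exact Or.inl h
  · exact Or.inr ⟨e, he, h⟩

/-- **`ε = 0` iff no Newton point lies below the level `β`** (i.e. `v` is the lowest point of the
polygon, `β` = CJS's minimal ordinate). [cite: Cutkosky2009, §10.1 p. 28 l. 35–37] -/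
theorem epsCu_eq_zero_iff : epsCu c J μ = 0 ↔ lowPts c J μ = ∅ := by
  constructor
  · intro h
    apply Set.eq_empty_of_forall_notMem
    intro e he
    have := slopeOf_le_epsCu he
    rw [h] at this
    exact absurd (slopeOf_pos_of_mem_lowPts he) (not_lt.mpr this)
  · intro h
    rcases epsCu_eq_zero_or_exists (c := c) (J := J) (μ := μ) with h0 | ⟨e, he, -⟩
    · exact h0
    · rw [h] at he; exact absurd he (Set.notMem_empty _)

/-- `ε > 0` iff some Newton point lies below the level `β`. [cite: Cutkosky2009, §10.1 p. 28 l. 35–37] -/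
theorem epsCu_pos_iff : 0 < epsCu c J μ ↔ (lowPts c J μ).Nonempty := by
  rw [(epsCu_nonneg c J μ).lt_iff_ne, ne_comm, Ne, epsCu_eq_zero_iff,
    Set.nonempty_iff_ne_empty]

/-- With no point below `β`, the tree's minimal ordinate `epsS` (CJS's `ε`) is `β`.
[cite: CossartJannsenSaito2020, Def. 11.1] -/
theorem betaS_eq_epsS_of_lowPts_eq_empty (hne : (pts c J μ).Nonempty) (h : lowPts c J μ = ∅) :
    betaS c J μ = epsS c J μ := by
  apply le_antisymm
  · obtain ⟨e, he, h2⟩ := exists_pts_epsS hne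
    rw [← h2]
    by_contra hlt
    have : e ∈ lowPts c J μ := ⟨he, not_le.mp hlt⟩
    rw [h] at this; exact absurd this (Set.notMem_empty e)
  · obtain ⟨e, he, -, h2⟩ := exists_pts_v hne
    rw [← h2]; exact epsS_le he

/-- **The printed characterisation**: among the non-positive slopes `σ` (the only candidates, since
`(α + t, β) ∈ |Δ|` for `t > 0` lies below every line through `v` of positive slope), `σ = −ε` is the
LARGEST slope of a line through `v = (α, β)` with no Newton point below it.
[cite: Cutkosky2009, §10.1 p. 28 l. 35–37] -/
theorem isGreatest_slope_through_vertex :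
    IsGreatest {σ : ℚ | σ ≤ 0 ∧ ∀ e ∈ pts c J μ,
      (betaS c J μ : ℚ) + σ * ((spt₁ μ e : ℚ) - alphaS c J μ) ≤ spt₂ μ e} (-epsCu c J μ) := by
  refine ⟨⟨neg_nonpos.mpr (epsCu_nonneg c J μ), fun e he => ?_⟩, fun σ ⟨hσ, hall⟩ => ?_⟩
  · have := sub_le_epsCu_mul he; linarith
  · -- `−σ` bounds every slope, hence `−σ ≥ ε` by maximality among ATTAINED values
    rcases epsCu_eq_zero_or_exists (c := c) (J := J) (μ := μ) with h0 | ⟨e, he, heq⟩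
    · rw [h0, neg_zero]; exact hσ
    · have h1 : (alphaS c J μ : ℚ) < spt₁ μ e := by
        exact_mod_cast alphaS_lt_spt₁_of_mem_lowPts he
      have hle := hall e he.1
      rw [← heq]
      unfold slopeOf
      rw [le_neg, div_le_iff₀ (by linarith)]
      linarith

/-! ## `1/ε` and `Ω` -/
variable (c J μ)

/-- `1/ε ∈ ℚ ∪ {∞}` (`⊤ = ∞` exactly when `ε = 0`). [cite: Cutkosky2009, §10.1 p. 28 l. 38–53] -/
def invEpsCu : WithTop ℚ := if epsCu c J μ = 0 then ⊤ else ((epsCu c J μ)⁻¹ : ℚ)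

/-- **Cutkosky's `Ω(I; x, y, z) = (β, 1/ε, α)`** "in the ordered set (by the Lex order)
`(1/r!)ℕ × (ℚ ∪ ∞) × (1/r!)ℕ`", with `β, α` carried SCALED by `L = μ!` (`betaS`, `alphaS`): for a
fixed `μ = r` the map `Ω ↦ OmegaCu` is strictly monotone, so every printed comparison is unchanged.
[cite: Cutkosky2009, §10.1 p. 28 l. 38–53] -/
def OmegaCu : ℕ ×ₗ (WithTop ℚ ×ₗ ℕ) := toLex (betaS c J μ, toLex (invEpsCu c J μ, alphaS c J μ))

variable {c J μ}

/-- `1/ε = ∞ ⟺ ε = 0`. [cite: Cutkosky2009, §10.1 p. 28 l. 38–53] -/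
theorem invEpsCu_eq_top_iff : invEpsCu c J μ = ⊤ ↔ epsCu c J μ = 0 := by
  unfold invEpsCu
  split_ifs with h
  · simp [h]
  · simp [h]

/-- `1/ε` is `∞` or a positive rational ("`(ℚ ∪ ∞)`"). [cite: Cutkosky2009, §10.1 p. 28 l. 38–53] -/
theorem invEpsCu_top_or_pos : invEpsCu c J μ = ⊤ ∨ ∃ q : ℚ, 0 < q ∧ invEpsCu c J μ = q := by
  unfold invEpsCu
  split_ifs with h
  · exact Or.inl rfl
  · exact Or.inr ⟨_, inv_pos.mpr ((epsCu_nonneg c J μ).lt_of_ne (Ne.symm h)), rfl⟩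

end Eps

/-! ## "`Ω` cannot decrease indefinitely" -/

section Descent
/-- First component `β` of a value of `Ω`. [folklore] -/
def bC (Ω : ℕ ×ₗ (WithTop ℚ ×ₗ ℕ)) : ℕ := (ofLex Ω).1
/-- Middle component `1/ε` of a value of `Ω`. [folklore] -/
def mC (Ω : ℕ ×ₗ (WithTop ℚ ×ₗ ℕ)) : WithTop ℚ := (ofLex (ofLex Ω).2).1
/-- Last component `α` of a value of `Ω`. [folklore] -/
def aC (Ω : ℕ ×ₗ (WithTop ℚ ×ₗ ℕ)) : ℕ := (ofLex (ofLex Ω).2).2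

/-- Components of `OmegaCu`. [cite: Cutkosky2009, §10.1 p. 28 l. 38–53] -/
@[simp] theorem bC_OmegaCu (c : Fin 3 → R) (J : Ideal R) (μ : ℕ) : bC (OmegaCu c J μ) = betaS c J μ := rfl
/-- Components of `OmegaCu`. [cite: Cutkosky2009, §10.1 p. 28 l. 38–53] -/
@[simp] theorem mC_OmegaCu (c : Fin 3 → R) (J : Ideal R) (μ : ℕ) : mC (OmegaCu c J μ) = invEpsCu c J μ := rfl
/-- Components of `OmegaCu`. [cite: Cutkosky2009, §10.1 p. 28 l. 38–53] -/
@[simp] theorem aC_OmegaCu (c : Fin 3 → R) (J : Ideal R) (μ : ℕ) : aC (OmegaCu c J μ) = alphaS c J μ := rfl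

/-- **Cutkosky's step law for `Ω`** (the shape of Theorem 10.18's conclusion, one step): `Ω' < Ω`
lexicographically; both middle components are `∞` or positive (`1/ε`, `ε ≥ 0` rational); and
"if `β_{n+1} = β_n`, `ε_{n+1} ≠ ε_n` and `1/ε_n ≠ ∞`, then `1/ε_{n+1} = 1/ε_n − 1`".
[cite: Cutkosky2009, Thm. 10.18 p. 36 l. 55–72] -/
def CuStep (Ω' Ω : ℕ ×ₗ (WithTop ℚ ×ₗ ℕ)) : Prop :=
  Ω' < Ω ∧ (mC Ω' = ⊤ ∨ ∃ q : ℚ, 0 < q ∧ mC Ω' = q) ∧ (mC Ω = ⊤ ∨ ∃ q : ℚ, 0 < q ∧ mC Ω = q) ∧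
    (bC Ω' = bC Ω → mC Ω' ≠ mC Ω → mC Ω ≠ ⊤ → mC Ω' + 1 = mC Ω)

/-- The termination potential `(β, [1/ε = ∞], ⌈1/ε⌉, α) ∈ ℕ⁴` (ours). [folklore] -/
private def potential (Ω : ℕ ×ₗ (WithTop ℚ ×ₗ ℕ)) : ℕ ×ₗ (ℕ ×ₗ (ℕ ×ₗ ℕ)) :=
  toLex (bC Ω, toLex (if mC Ω = ⊤ then 1 else 0,
    toLex (WithTop.recTopCoe 0 (fun q : ℚ => ⌈q⌉₊) (mC Ω), aC Ω)))

/-- Unfolding "the Lex order" on `ℕ ×ₗ (WithTop ℚ ×ₗ ℕ)` through the components.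
[cite: Cutkosky2009, §10.1 p. 28 l. 43] -/
theorem lt_iff_components (Ω' Ω : ℕ ×ₗ (WithTop ℚ ×ₗ ℕ)) :
    Ω' < Ω ↔ bC Ω' < bC Ω ∨ bC Ω' = bC Ω ∧ (mC Ω' < mC Ω ∨ mC Ω' = mC Ω ∧ aC Ω' < aC Ω) := by
  have h1 : Ω' < Ω ↔ (ofLex Ω').1 < (ofLex Ω).1 ∨
      (ofLex Ω').1 = (ofLex Ω).1 ∧ (ofLex Ω').2 < (ofLex Ω).2 := Prod.Lex.lt_iff
  have h2 : (ofLex Ω').2 < (ofLex Ω).2 ↔ (ofLex (ofLex Ω').2).1 < (ofLex (ofLex Ω).2).1 ∨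
      (ofLex (ofLex Ω').2).1 = (ofLex (ofLex Ω).2).1 ∧
        (ofLex (ofLex Ω').2).2 < (ofLex (ofLex Ω).2).2 := Prod.Lex.lt_iff
  rw [h1, h2]; rfl

/-- One step of the law strictly decreases the potential (ours). [folklore] -/
private theorem potential_lt_of_cuStep {Ω' Ω : ℕ ×ₗ (WithTop ℚ ×ₗ ℕ)} (h : CuStep Ω' Ω) :
    potential Ω' < potential Ω := by
  obtain ⟨hlt, hpos', hpos, hlaw⟩ := h
  rw [lt_iff_components] at hlt
  unfold potential
  simp only [Prod.Lex.lt_iff, ofLex_toLex]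
  rcases hlt with hb | ⟨hb, hrest⟩
  · exact Or.inl hb
  · refine Or.inr ⟨hb, ?_⟩
    rcases hrest with hm | ⟨hm, ha⟩
    · -- the middle component drops
      rcases hpos with htop | ⟨q, hq, hmq⟩
      · -- from `∞` to a finite value: the indicator drops
        have hne : mC Ω' ≠ ⊤ := by rw [← htop]; exact hm.ne
        refine Or.inl ?_
        rw [if_neg hne, if_pos htop]; exact Nat.zero_lt_one
      · -- finite: drops by exactly one, so the ceiling drops
        have hne : mC Ω ≠ ⊤ := by rw [hmq]; exact WithTop.coe_ne_top
        have hlaw' := hlaw hb hm.ne hne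
        rcases hpos' with htop' | ⟨q', hq', hmq'⟩
        · rw [htop'] at hm; exact absurd hm (not_lt.mpr le_top)
        · have hqq : q' + 1 = q := by
            rw [hmq', hmq] at hlaw'
            exact_mod_cast hlaw'
          refine Or.inr ⟨by rw [if_neg hne, if_neg (by rw [hmq']; exact WithTop.coe_ne_top)], ?_⟩
          refine Or.inl ?_
          rw [hmq, hmq']
          simp only [WithTop.recTopCoe_coe]
          rw [← hqq]
          have : ⌈q' + 1⌉₊ = ⌈q'⌉₊ + 1 := Nat.ceil_add_one hq'.le
          omega
    · -- the middle component is unchanged and `α` drops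
      refine Or.inr ⟨by rw [hm], Or.inr ⟨by rw [hm], ha⟩⟩

/-- The step law is a well-founded relation on the codomain of `Ω` (although `<` itself is not
well-founded there). [cite: Cutkosky2009, p. 37 l. 78–80] -/
theorem wellFounded_cuStep : WellFounded CuStep :=
  Subrelation.wf (q := CuStep) (r := InvImage (· < ·) potential)
    (fun h => potential_lt_of_cuStep h) (InvImage.wf potential wellFounded_lt)

/-- **"The sequence `Ω(q_n)` cannot decrease indefinitely"**: there is no infinite chain for the step
law. [cite: Cutkosky2009, p. 37 l. 78–80; p. 25 l. 24–27] -/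
theorem no_infinite_descent (Ω : ℕ → ℕ ×ₗ (WithTop ℚ ×ₗ ℕ)) (h : ∀ n, CuStep (Ω (n + 1)) (Ω n)) :
    False :=
  (wellFounded_iff_isEmpty_descending_chain.mp wellFounded_cuStep).false ⟨Ω, h⟩

/-- The step law between two states of a polygon, spelled out on `OmegaCu`: it holds as soon as
`Ω` drops and the printed `1/ε` law holds (positivity of `1/ε` is automatic).
[cite: Cutkosky2009, Thm. 10.18 p. 36 l. 55–72] -/
theorem cuStep_OmegaCu {R' : Type u} [CommRing R'] {c : Fin 3 → R} {J : Ideal R} {μ : ℕ}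
    {c' : Fin 3 → R'} {J' : Ideal R'} {μ' : ℕ} (hlt : OmegaCu c' J' μ' < OmegaCu c J μ)
    (hlaw : betaS c' J' μ' = betaS c J μ → epsCu c' J' μ' ≠ epsCu c J μ → invEpsCu c J μ ≠ ⊤ →
      invEpsCu c' J' μ' + 1 = invEpsCu c J μ) :
    CuStep (OmegaCu c' J' μ') (OmegaCu c J μ) := by
  refine ⟨hlt, invEpsCu_top_or_pos, invEpsCu_top_or_pos, fun hb hm htop => hlaw hb ?_ htop⟩
  intro heq
  apply hm
  show invEpsCu c' J' μ' = invEpsCu c J μ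
  unfold invEpsCu; rw [heq]

end Descent

end Literature.AlgebraicGeometry.Resolution.Cutkosky2009
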